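import Literature.MathematicalPhysics.QuantumLattice.MatrixProductStatesAkltParentProofs
import Literature.MathematicalPhysics.QuantumLattice.MatrixProductStatesIntersectionProofs
import HarnessLib

/-!
# The AKLT finite-volume lemma: zero-energy states of the open chain are VBS states

Trunk **T-QLATTICE**. Theorem-only sibling proof file of
`Literature/MathematicalPhysics/QuantumLattice/MatrixProductStates.lean` (next to
`MatrixProductStatesAkltParentProofs.lean`, `MatrixProductStatesIntersectionProofs.lean`); no
statement or definition is introduced or changed. Main result:
`exists_mpsWithBoundary_akltTensor_of_parentLocalTerm_mulVec_eq_zero` — on `L ≥ 2` sites, a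
vector `ψ` all of whose two-site block slices are annihilated by the bond-spin-`2` projection
`P₂ = parentLocalTerm 2 akltTensor` (`parentLocalTerm_two_akltTensor`) is a matrix product state
`ψ_B(σ) = tr (B A^{σ₀} ⋯ A^{σ_{L-1}})` of the AKLT tensor (`mpsWithBoundary L akltTensor B`). With
the converse (`parentHamiltonianOpen_mulVec_mpsWithBoundary_eq_zero_holds`): the zero-energy space
of `Σ_x P₂(x, x+1)` on the open chain is the four-dimensional space `{ψ_B}` of valence-bond-solid
states with free boundary spins (consumer: the discharge of `aklt_open_degeneracy`). For the AKLT
tensor this is the full intersection property `⋂_j ℋ^{⊗j} ⊗ 𝒢₂ ⊗ ℋ^{⊗(L-j-2)} = 𝒢_L` including the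
step `2 → 3` sites, which the tensor-generic `exists_boundary_of_twoSiteSlices` takes as a
hypothesis.

## Source and proof

I. Affleck, T. Kennedy, E. H. Lieb, H. Tasaki, *Valence bond ground states in isotropic quantum
antiferromagnets*, Comm. Math. Phys. **115** (1988) 477–528 (held: `paper:doi-10-1007-bf01218021`)
[AffleckEtAl1988]: §2.1 (VBS states `Ω_{αβ}` of the open chain, eq. (2.7); Remark 1, p. 484:
"In Lemma 2.8 of Sect. 2.4 we will prove that they are the only finite volume ground states. Hence
the open chain has a fourfold degenerate ground state") and §2.4, **Lemma 2.8** (finite volume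
lemma, p. 493: a state with `H_i φ = 0` for all bonds is a combination of the four `Ω_{αβ}`; "The
proof proceeds by induction in the number of sites", pp. 494–495). Also H. Tasaki, *Physics and
Mathematics of Quantum Many-Body Systems* (2020), §7.1; Fannes–Nachtergaele–Werner, CMP **144**
(1992), §5 Lemma 5.5 and §7 [FannesNachtergaeleWernerCMP1992].

Physical index `k : Fin 3 ↦ m = 1 - k` (`0 = +`, `1 = 0`, `2 = -`); `A⁺ = s σ⁺`, `A⁰ = -t σᶻ`,
`A⁻ = -s σ⁻`, `s² = 2/3`, `t² = 1/3` (`akltTensor_eq_of_sq`; all lemmas take this presentation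
`hA` as a hypothesis). (1) `akltProj_mulVec_eq_zero_eqns`: `P₂ v = 0` gives the five linear
relations "`v ⊥` the spin-`2` quintet `|++⟩, |--⟩, |+0⟩+|0+⟩, |0-⟩+|-0⟩, |+-⟩+2|00⟩+|-+⟩`"
(AKLT p. 484, the basis `e₁,…,e₅`; from `spinDot_two_mulVec_apply`). (2) Base `L = 2`:
`v = v - P₂ v = ψ_{B(v)}` (`mpsWithBoundary_two_aklt_eq_sub_akltProj_mulVec`). (3) Step (AKLT
p. 495): freezing the last site `a`, `σ ↦ ψ(σ, a) = tr (B_a A^σ)` by induction; the last-bond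
condition on the words `(0,…,0,±)` (products `∝ σ^±`, `wordProduct_akltTensor_const_one_snoc_*`)
is ten linear equations for `B₊, B₀, B₋` (`aklt_boundary_eq_of_lastBond`) solved by `B_a = A^a D`,
`D = (A⁰)⁻¹ B₀ = diag(-3t, 3t) B₀`; then `ψ(σ, a) = tr (A^a D A^σ) = tr (D A^σ A^a) = ψ_D(σ, a)`.
Glued configurations `σ[x, x+1 := w] = Function.extend (i ↦ x + i) w σ` (as in
`localOp_chainBlock_submatrix_mulVec_apply`) versus `Fin.snoc`: `extend_pairSite_*`.
-/

noncomputable section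

open Matrix Complex

namespace Literature.MathematicalPhysics.QuantumLattice

section QLattice

variable {q D : ℕ}

/-! ### The kernel of `P₂` on two sites: five linear equations -/

/-- **`ker P₂` is cut out by five linear equations.** If the bond-spin-`2` projection
`P₂ = parentLocalTerm 2 akltTensor` kills a two-site vector `v` (indices `0 = +, 1 = 0, 2 = -`),
then `v(+,+) = 0`, `v(-,-) = 0`, `v(+,0) + v(0,+) = 0`, `v(0,-) + v(-,0) = 0` and
`v(+,-) + 2 v(0,0) + v(-,+) = 0`, i.e. `v` is orthogonal to the spin-`2` quintet `e₁, …, e₅` of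
AKLT (1988), §2.1 (p. 484); these are the components `(P₂ v)(+,+)`, `(P₂ v)(-,-)`, `2 (P₂ v)(+,0)`,
`2 (P₂ v)(0,-)`, `3 (P₂ v)(0,0)` (`parentLocalTerm_two_akltTensor`, `spinDot_two_mulVec_apply`).
[cite: AffleckEtAl1988, §2.1 p. 484] -/
theorem akltProj_mulVec_eq_zero_eqns (v : (Fin 2 → Fin 3) → ℂ)
    (hv : parentLocalTerm 2 akltTensor *ᵥ v = 0) :
    v ![0, 0] = 0 ∧ v ![2, 2] = 0 ∧ v ![0, 1] + v ![1, 0] = 0 ∧ v ![1, 2] + v ![2, 1] = 0 ∧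
      v ![0, 2] + 2 * v ![1, 1] + v ![2, 0] = 0 := by
  rw [parentLocalTerm_two_akltTensor] at hv
  have h := fun a b : Fin 3 => congr_fun hv ![a, b]
  simp only [akltProj_mulVec_apply, Pi.zero_apply] at h
  have h00 := h 0 0
  have h22 := h 2 2
  have h01 := h 0 1
  have h12 := h 1 2
  have h11 := h 1 1
  simp only [spinDot_two_mulVec_apply, Matrix.cons_val_zero, Matrix.cons_val_one,
    Matrix.cons_val] at h00 h22 h01 h12 h11
  refine ⟨?_, ?_, ?_, ?_, ?_⟩
  · linear_combination h00
  · linear_combination h22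
  · linear_combination (2 : ℂ) * h01
  · linear_combination (2 : ℂ) * h12
  · linear_combination (3 : ℂ) * h11

/-! ### The induction step: the last bond determines the boundary matrices -/

/-- The two-site amplitudes `(u, a) ↦ tr (B_a σ⁺ A^u)` (a word ending in the matrix unit
`σ⁺ = E₀₁` followed by one more letter): `0`, `t (B_a)₁₀`, `-s (B_a)₀₀` for `u = +, 0, -`.
[folklore] -/
theorem trace_mul_single01_mul_akltTensor {s t : ℂ}
    (hA : akltTensor = ![!![0, s; 0, 0], !![-t, 0; 0, t], !![0, 0; -s, 0]])
    (B : Matrix (Fin 2) (Fin 2) ℂ) (a : Fin 3) :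
    (B * ((!![0, 1; 0, 0] : Matrix (Fin 2) (Fin 2) ℂ) * akltTensor a)).trace =
      ![0, t * B 1 0, -(s * B 0 0)] a := by
  rw [hA]
  fin_cases a <;> simp [Matrix.trace_fin_two, Matrix.mul_apply, Fin.sum_univ_two] <;> ring

/-- The two-site amplitudes `(u, a) ↦ tr (B_a σ⁻ A^u)` (a word ending in the matrix unit
`σ⁻ = E₁₀` followed by one more letter): `s (B_a)₁₁`, `-t (B_a)₀₁`, `0` for `u = +, 0, -`.
[folklore] -/
theorem trace_mul_single10_mul_akltTensor {s t : ℂ}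
    (hA : akltTensor = ![!![0, s; 0, 0], !![-t, 0; 0, t], !![0, 0; -s, 0]])
    (B : Matrix (Fin 2) (Fin 2) ℂ) (a : Fin 3) :
    (B * ((!![0, 0; 1, 0] : Matrix (Fin 2) (Fin 2) ℂ) * akltTensor a)).trace =
      ![s * B 1 1, -(t * B 0 1), 0] a := by
  rw [hA]
  fin_cases a <;> simp [Matrix.trace_fin_two, Matrix.mul_apply, Fin.sum_univ_two] <;> ring

/-- The products `A^k diag(-3t, 3t) X` entrywise (`A⁺ D X`, `A⁰ D X = 3t² X`, `A⁻ D X`).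
[folklore] -/
theorem akltTensor_mul_diag_mul {s t : ℂ}
    (hA : akltTensor = ![!![0, s; 0, 0], !![-t, 0; 0, t], !![0, 0; -s, 0]])
    (X : Matrix (Fin 2) (Fin 2) ℂ) (k : Fin 3) :
    akltTensor k * (!![-3 * t, 0; 0, 3 * t] * X) =
      (![!![3 * s * t * X 1 0, 3 * s * t * X 1 1; 0, 0],
        !![3 * t ^ 2 * X 0 0, 3 * t ^ 2 * X 0 1; 3 * t ^ 2 * X 1 0, 3 * t ^ 2 * X 1 1],
        !![0, 0; 3 * s * t * X 0 0, 3 * s * t * X 0 1]] : Fin 3 → Matrix (Fin 2) (Fin 2) ℂ) k := by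
  rw [hA]
  fin_cases k <;> ext i j <;> fin_cases i <;> fin_cases j <;>
    simp [Matrix.mul_apply, Fin.sum_univ_two, -Matrix.cons_mul] <;> ring

/-- **The induction step of AKLT's finite-volume lemma** (AKLT (1988), proof of Lemma 2.8,
p. 495: "the argument for three sites can now be used to conclude"). Let `B₊, B₀, B₋` be the
boundary matrices of the slices `σ ↦ ψ(σ, a)` of a zero-energy state on one more site. If the
last-bond condition `P₂ (u, a) ↦ tr (B_a W A^u) = 0` holds for the two words `W = σ⁺` and
`W = σ⁻`, then `B_a = A^a D` for the single matrix `D = (A⁰)⁻¹ B₀ = diag(-3t, 3t) B₀`: the ten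
linear equations of `akltProj_mulVec_eq_zero_eqns` for the two slices
(`trace_mul_single01/10_mul_akltTensor`) solve to this, using `s² = 2/3`, `t² = 1/3`.
[cite: AffleckEtAl1988, §2.4 Lemma 2.8 (proof, p. 495)] -/
theorem aklt_boundary_eq_of_lastBond {s t : ℂ}
    (hA : akltTensor = ![!![0, s; 0, 0], !![-t, 0; 0, t], !![0, 0; -s, 0]])
    (hs : s ^ 2 = 2 / 3) (ht : t ^ 2 = 1 / 3) (B : Fin 3 → Matrix (Fin 2) (Fin 2) ℂ)
    (h01 : parentLocalTerm 2 akltTensor *ᵥ (fun w : Fin 2 → Fin 3 =>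
      (B (w 1) * ((!![0, 1; 0, 0] : Matrix (Fin 2) (Fin 2) ℂ) * akltTensor (w 0))).trace) = 0)
    (h10 : parentLocalTerm 2 akltTensor *ᵥ (fun w : Fin 2 → Fin 3 =>
      (B (w 1) * ((!![0, 0; 1, 0] : Matrix (Fin 2) (Fin 2) ℂ) * akltTensor (w 0))).trace) = 0)
    (k : Fin 3) :
    B k = akltTensor k * (!![-3 * t, 0; 0, 3 * t] * B 1) := by
  have ha := akltProj_mulVec_eq_zero_eqns _ h01
  have hb := akltProj_mulVec_eq_zero_eqns _ h10
  simp only [trace_mul_single01_mul_akltTensor hA, trace_mul_single10_mul_akltTensor hA] at ha hb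
  simp only [Matrix.cons_val_zero, Matrix.cons_val_one, Matrix.cons_val] at ha hb
  obtain ⟨-, e2a, e3a, e4a, e5a⟩ := ha
  obtain ⟨e1b, -, e3b, e4b, e5b⟩ := hb
  rw [akltTensor_mul_diag_mul hA]
  fin_cases k
  · ext i j
    fin_cases i <;> fin_cases j <;>
      simp only [Matrix.cons_val_zero, Matrix.of_apply, Matrix.cons_val', Matrix.cons_val_one,
        Fin.zero_eta, Fin.mk_one, Fin.isValue]
    · linear_combination (-(3 : ℂ) / 2 * s) * e5a + (-(3 : ℂ) / 2 * B 0 0 0) * hs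
    · linear_combination (-3 * t) * e3b + (-3 * B 0 0 1) * ht
    · linear_combination (3 * t) * e3a + (-3 * B 0 1 0) * ht
    · linear_combination ((3 : ℂ) / 2 * s) * e1b + (-(3 : ℂ) / 2 * B 0 1 1) * hs
  · ext i j
    fin_cases i <;> fin_cases j <;>
      simp only [Matrix.cons_val_one, Matrix.of_apply, Matrix.cons_val', Matrix.cons_val_zero,
        Fin.zero_eta, Fin.mk_one, Fin.isValue]
    · linear_combination (-3 * B 1 0 0) * ht
    · linear_combination (-3 * B 1 0 1) * ht
    · linear_combination (-3 * B 1 1 0) * ht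
    · linear_combination (-3 * B 1 1 1) * ht
  · ext i j
    fin_cases i <;> fin_cases j <;>
      simp only [Fin.reduceFinMk, Matrix.cons_val, Matrix.of_apply, Matrix.cons_val',
        Matrix.cons_val_zero, Matrix.cons_val_one, Fin.zero_eta, Fin.mk_one, Fin.isValue]
    · linear_combination (-(3 : ℂ) / 2 * s) * e2a + (-(3 : ℂ) / 2 * B 2 0 0) * hs
    · linear_combination (-3 * t) * e4b + (-3 * B 2 0 1) * ht
    · linear_combination (3 * t) * e4a + (-3 * B 2 1 0) * ht
    · linear_combination ((3 : ℂ) / 2 * s) * e5b + (-(3 : ℂ) / 2 * B 2 1 1) * hs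

/-! ### Word products: powers of `A⁰` followed by `A^±` -/

/-- Powers of the diagonal letter: `(A⁰)ⁿ = diag((-t)ⁿ, tⁿ)`. [folklore] -/
theorem wordProduct_akltTensor_const_one {s t : ℂ}
    (hA : akltTensor = ![!![0, s; 0, 0], !![-t, 0; 0, t], !![0, 0; -s, 0]]) (n : ℕ) :
    wordProduct akltTensor (fun _ : Fin n => (1 : Fin 3)) = !![(-t) ^ n, 0; 0, t ^ n] := by
  induction n with
  | zero => ext i j; fin_cases i <;> fin_cases j <;> simp [wordProduct]
  | succ n ih =>
    have h : (fun _ : Fin (n + 1) => (1 : Fin 3)) = Fin.snoc (fun _ : Fin n => (1 : Fin 3)) 1 := by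
      funext i
      refine Fin.lastCases ?_ (fun j => ?_) i <;> simp
    rw [h, wordProduct_snoc, ih, hA]
    ext i j
    fin_cases i <;> fin_cases j <;> simp [Matrix.mul_apply, Fin.sum_univ_two, pow_succ]

/-- The word `(0, …, 0, +)` has product `(A⁰)ⁿ A⁺ = (-t)ⁿ s · σ⁺`, a multiple of the matrix unit
`E₀₁`. [folklore] -/
theorem wordProduct_akltTensor_const_one_snoc_zero {s t : ℂ}
    (hA : akltTensor = ![!![0, s; 0, 0], !![-t, 0; 0, t], !![0, 0; -s, 0]]) (n : ℕ) :
    wordProduct akltTensor (Fin.snoc (fun _ : Fin n => (1 : Fin 3)) 0 : Fin (n + 1) → Fin 3) =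
      ((-t) ^ n * s) • !![0, 1; 0, 0] := by
  rw [wordProduct_snoc, wordProduct_akltTensor_const_one hA, hA]
  ext i j
  fin_cases i <;> fin_cases j <;> simp [Matrix.mul_apply, Fin.sum_univ_two]

/-- The word `(0, …, 0, -)` has product `(A⁰)ⁿ A⁻ = -tⁿ s · σ⁻`, a multiple of the matrix unit
`E₁₀`. [folklore] -/
theorem wordProduct_akltTensor_const_one_snoc_two {s t : ℂ}
    (hA : akltTensor = ![!![0, s; 0, 0], !![-t, 0; 0, t], !![0, 0; -s, 0]]) (n : ℕ) :
    wordProduct akltTensor (Fin.snoc (fun _ : Fin n => (1 : Fin 3)) 2 : Fin (n + 1) → Fin 3) =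
      (-(t ^ n * s)) • !![0, 0; 1, 0] := by
  rw [wordProduct_snoc, wordProduct_akltTensor_const_one hA, hA]
  ext i j
  fin_cases i <;> fin_cases j <;> simp [Matrix.mul_apply, Fin.sum_univ_two]

/-! ### Two-site blocks and glued configurations -/

/-- The glued configuration `σ[x, x+1 := w] = Function.extend (i ↦ x + i) w σ` of a two-site
block `{x, x+1}` (the form in which block operators act on vectors,
`localOp_chainBlock_submatrix_mulVec_apply`), evaluated: `w 0` at `x`, `w 1` at `x + 1`, `σ`
elsewhere. [folklore] -/
theorem extend_pairSite_apply {L : ℕ} (x : ℕ) (hx : x + 2 ≤ L) (w : Fin 2 → Fin q)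
    (σ : Fin L → Fin q) (y : Fin L) :
    Function.extend (fun i : Fin 2 => (⟨x + i, by omega⟩ : Fin L)) w σ y =
      if (y : ℕ) = x then w 0 else if (y : ℕ) = x + 1 then w 1 else σ y := by
  have hinj : Function.Injective fun i : Fin 2 => (⟨x + i, by omega⟩ : Fin L) := by
    intro i j hij
    have hv := congrArg Fin.val hij
    dsimp only at hv
    exact Fin.ext (by omega)
  split_ifs with h0 h1
  · have hy : y = (fun i : Fin 2 => (⟨x + i, by omega⟩ : Fin L)) 0 := Fin.ext (by simpa using h0)
    rw [hy, hinj.extend_apply]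
  · have hy : y = (fun i : Fin 2 => (⟨x + i, by omega⟩ : Fin L)) 1 := Fin.ext (by simpa using h1)
    rw [hy, hinj.extend_apply]
  · refine Function.extend_apply' _ _ _ ?_
    rintro ⟨i, rfl⟩
    fin_cases i
    · exact h0 (by simp)
    · exact h1 (by simp)

/-- On two sites the block `{0, 1}` is everything: `σ[0, 1 := w] = w`. [folklore] -/
theorem extend_pairSite_two (w : Fin 2 → Fin q) (σ : Fin 2 → Fin q) :
    Function.extend (fun i : Fin 2 => (⟨0 + i, by omega⟩ : Fin 2)) w σ = w := by
  funext y
  rw [extend_pairSite_apply 0 (le_refl 2)]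
  fin_cases y <;> simp

/-- Gluing into a block not containing the last site commutes with freezing the last site:
`(σ, a)[x, x+1 := w] = (σ[x, x+1 := w], a)` for `x + 1 < n + 2`. [folklore] -/
theorem extend_pairSite_snoc {n : ℕ} (x : ℕ) (hx : x + 2 ≤ n + 2) (w : Fin 2 → Fin q)
    (σ : Fin (n + 2) → Fin q) (a : Fin q) :
    Function.extend (fun i : Fin 2 => (⟨x + i, by omega⟩ : Fin (n + 1 + 2))) w
        (Fin.snoc σ a : Fin (n + 2 + 1) → Fin q) =
      Fin.snoc (Function.extend (fun i : Fin 2 => (⟨x + i, by omega⟩ : Fin (n + 2))) w σ) a := by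
  funext y
  rw [extend_pairSite_apply x (by omega)]
  refine Fin.lastCases ?_ (fun j => ?_) y
  · split_ifs with h1 h2
    · rw [Fin.val_last] at h1
      omega
    · rw [Fin.val_last] at h2
      omega
    · simp only [Fin.snoc_last]
  · simp only [Fin.val_castSucc, Fin.snoc_castSucc, extend_pairSite_apply x hx]

/-- Gluing into the last block `{n+1, n+2}` overwrites the last two sites:
`(ρ, a, b)[n+1, n+2 := w] = (ρ, w 0, w 1)`. [folklore] -/
theorem extend_pairSite_snoc_snoc {n : ℕ} (w : Fin 2 → Fin q) (ρ : Fin (n + 1) → Fin q)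
    (a b : Fin q) :
    Function.extend (fun i : Fin 2 => (⟨n + 1 + i, by omega⟩ : Fin (n + 1 + 2))) w
        (Fin.snoc (Fin.snoc ρ a : Fin (n + 2) → Fin q) b : Fin (n + 2 + 1) → Fin q) =
      Fin.snoc (Fin.snoc ρ (w 0) : Fin (n + 2) → Fin q) (w 1) := by
  funext y
  rw [extend_pairSite_apply (n + 1) (le_refl _)]
  refine Fin.lastCases ?_ (fun j => ?_) y
  · split_ifs with h1 h2
    · rw [Fin.val_last] at h1
      omega
    · simp only [Fin.snoc_last]
    · rw [Fin.val_last] at h2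
      omega
  · refine Fin.lastCases ?_ (fun k => ?_) j
    · split_ifs with h1 h2
      · simp only [Fin.snoc_castSucc, Fin.snoc_last]
      · rw [Fin.val_castSucc, Fin.val_last] at h2
        omega
      · rw [Fin.val_castSucc, Fin.val_last] at h1
        omega
    · split_ifs with h1 h2
      · rw [Fin.val_castSucc, Fin.val_castSucc] at h1
        omega
      · rw [Fin.val_castSucc, Fin.val_castSucc] at h2
        omega
      · simp only [Fin.snoc_castSucc]

/-! ### The induction -/

/-- Scaling the word `W` scales the two-site slice `(u, a) ↦ tr (B_a W A^u)`. [folklore] -/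
theorem akltSlice_smul (c : ℂ) (B : Fin 3 → Matrix (Fin 2) (Fin 2) ℂ)
    (E : Matrix (Fin 2) (Fin 2) ℂ) :
    (fun w : Fin 2 → Fin 3 => (B (w 1) * ((c • E) * akltTensor (w 0))).trace) =
      c • fun w : Fin 2 → Fin 3 => (B (w 1) * (E * akltTensor (w 0))).trace := by
  funext w
  simp only [Pi.smul_apply, smul_eq_mul, Matrix.smul_mul, Matrix.mul_smul, Matrix.trace_smul]

/-- **AKLT's finite-volume lemma (Lemma 2.8), by induction on the length.** Given the presentation
`A⁺ = s σ⁺, A⁰ = -t σᶻ, A⁻ = -s σ⁻` (`s² = 2/3`, `t² = 1/3`) of `akltTensor`, for every `n` a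
vector `ψ` on `n + 2` spin-`1` sites all of whose two-site block slices `w ↦ ψ(σ[x, x+1 := w])`
(`x + 2 ≤ n + 2`) are annihilated by the bond-spin-`2` projection `P₂ = parentLocalTerm 2 akltTensor`
is a matrix product state `ψ_B` for some boundary matrix `B`. Induction on `n` as in AKLT (1988),
proof of Lemma 2.8 (pp. 494–495): the base is `ran (1 - P₂) ⊆ 𝒢₂`
(`mpsWithBoundary_two_aklt_eq_sub_akltProj_mulVec`); in the step the slices with frozen last site
are `ψ_{B_a}` by induction, the last-bond condition on the words `(0,…,0,±)`
(`wordProduct_akltTensor_const_one_snoc_zero/two`, nonzero multiples of `σ^±`) forces `B_a = A^a D`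
(`aklt_boundary_eq_of_lastBond`), and `tr (A^a D A^σ) = tr (D A^σ A^a)`.
[cite: AffleckEtAl1988, §2.4 Lemma 2.8] -/
theorem aklt_exists_boundary_of_slices {s t : ℂ}
    (hA : akltTensor = ![!![0, s; 0, 0], !![-t, 0; 0, t], !![0, 0; -s, 0]])
    (hs : s ^ 2 = 2 / 3) (ht : t ^ 2 = 1 / 3) (n : ℕ) (ψ : (Fin (n + 2) → Fin 3) → ℂ)
    (hψ : ∀ (x : ℕ) (hx : x + 2 ≤ n + 2) (σ : Fin (n + 2) → Fin 3),
      parentLocalTerm 2 akltTensor *ᵥ (fun w => ψ (Function.extend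
        (fun i : Fin 2 => (⟨x + i, by omega⟩ : Fin (n + 2))) w σ)) = 0) :
    ∃ B : Matrix (Fin 2) (Fin 2) ℂ, ψ = mpsWithBoundary (n + 2) akltTensor B := by
  induction n with
  | zero =>
    have h0 := hψ 0 (le_refl _) (fun _ => 0)
    have hext : (fun w : Fin 2 → Fin 3 => ψ (Function.extend
        (fun i : Fin 2 => (⟨0 + i, by omega⟩ : Fin (0 + 2))) w (fun _ => 0))) = ψ := by
      funext w
      rw [extend_pairSite_two]
    rw [hext, parentLocalTerm_two_akltTensor] at h0
    have h := mpsWithBoundary_two_aklt_eq_sub_akltProj_mulVec s t hs ht ψ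
    rw [h0, sub_zero, ← hA] at h
    exact ⟨_, h.symm⟩
  | succ n ih =>
    -- freezing the last site gives a state on `n + 2` sites satisfying all block conditions
    have hψs : ∀ a : Fin 3, ∃ B : Matrix (Fin 2) (Fin 2) ℂ,
        (fun σ : Fin (n + 2) → Fin 3 => ψ (Fin.snoc σ a)) = mpsWithBoundary (n + 2) akltTensor B := by
      intro a
      refine ih _ fun x hx σ => ?_
      have h := hψ x (by omega) (Fin.snoc σ a)
      simp only [extend_pairSite_snoc x hx] at h
      exact h
    choose B hB using hψs
    -- the last-bond condition in terms of the boundary matrices `B a`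
    have hlast : ∀ ρ : Fin (n + 1) → Fin 3, parentLocalTerm 2 akltTensor *ᵥ
        (fun w : Fin 2 → Fin 3 =>
          (B (w 1) * (wordProduct akltTensor ρ * akltTensor (w 0))).trace) = 0 := by
      intro ρ
      have h := hψ (n + 1) (le_refl _) (Fin.snoc (Fin.snoc ρ 0 : Fin (n + 2) → Fin 3) 0)
      have e : (fun w : Fin 2 → Fin 3 => ψ (Function.extend
          (fun i : Fin 2 => (⟨n + 1 + i, by omega⟩ : Fin (n + 1 + 2))) w
            (Fin.snoc (Fin.snoc ρ 0 : Fin (n + 2) → Fin 3) 0))) =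
          fun w : Fin 2 → Fin 3 =>
            (B (w 1) * (wordProduct akltTensor ρ * akltTensor (w 0))).trace := by
        funext w
        rw [extend_pairSite_snoc_snoc]
        have hw := congr_fun (hB (w 1)) (Fin.snoc ρ (w 0))
        rw [hw, mpsWithBoundary, wordProduct_snoc]
      rw [e] at h
      exact h
    have hs0 : s ≠ 0 := by rintro rfl; norm_num at hs
    have ht0 : t ≠ 0 := by rintro rfl; norm_num at ht
    have h01 := hlast (Fin.snoc (fun _ : Fin n => (1 : Fin 3)) 0)
    rw [wordProduct_akltTensor_const_one_snoc_zero hA, akltSlice_smul, mulVec_smul,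
      smul_eq_zero_iff_right (mul_ne_zero (pow_ne_zero _ (neg_ne_zero.2 ht0)) hs0)] at h01
    have h10 := hlast (Fin.snoc (fun _ : Fin n => (1 : Fin 3)) 2)
    rw [wordProduct_akltTensor_const_one_snoc_two hA, akltSlice_smul, mulVec_smul,
      smul_eq_zero_iff_right (neg_ne_zero.2 (mul_ne_zero (pow_ne_zero _ ht0) hs0))] at h10
    have hBk := aklt_boundary_eq_of_lastBond hA hs ht B h01 h10
    refine ⟨!![-3 * t, 0; 0, 3 * t] * B 1, funext fun σ => ?_⟩
    obtain ⟨τ, k, rfl⟩ : ∃ (τ : Fin (n + 2) → Fin 3) (k : Fin 3), σ = Fin.snoc τ k :=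
      ⟨Fin.init σ, σ (Fin.last _), (Fin.snoc_init_self σ).symm⟩
    have hk := congr_fun (hB k) τ
    rw [hk, mpsWithBoundary, mpsWithBoundary, wordProduct_snoc, hBk k, Matrix.mul_assoc,
      Matrix.trace_mul_comm, Matrix.mul_assoc, Matrix.mul_assoc]

/-- **AKLT's finite-volume lemma (Lemma 2.8) for the AKLT tensor.** On `L ≥ 2` sites, a vector
`ψ` all of whose two-site block slices `w ↦ ψ(σ[x, x+1 := w])` (`x + 2 ≤ L`) are annihilated
by `parentLocalTerm 2 akltTensor` — the bond-spin-`2` projection `P₂`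
(`parentLocalTerm_two_akltTensor`) — is one of the valence-bond-solid states with free boundary
spins, `ψ = ψ_B = mpsWithBoundary L akltTensor B` for some `B ∈ M₂(ℂ)`: "Let `φ` be a state
… which satisfies `H_i φ = 0` for all `i`. Then `φ` can be written as `Σ A^{αβ} Ω_{αβ}`"
(AKLT (1988), Lemma 2.8, p. 493; the four `Ω_{αβ}` are the `ψ_B` with `B` a matrix unit).
From `aklt_exists_boundary_of_slices` and `akltTensor_eq_of_sq`.
[cite: AffleckEtAl1988, §2.4 Lemma 2.8] -/
theorem exists_mpsWithBoundary_akltTensor_of_parentLocalTerm_mulVec_eq_zero (L : ℕ) (hL : 2 ≤ L)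
    (ψ : TensorIndex (Fin L) 3 → ℂ)
    (hψ : ∀ (x : ℕ) (hx : x + 2 ≤ L) (σ : TensorIndex (Fin L) 3),
      parentLocalTerm 2 akltTensor *ᵥ (fun w => ψ (Function.extend
        (fun i : Fin 2 => (⟨x + i, by omega⟩ : Fin L)) w σ)) = 0) :
    ∃ B : Matrix (Fin 2) (Fin 2) ℂ, ψ = mpsWithBoundary L akltTensor B := by
  obtain ⟨n, rfl⟩ : ∃ n, L = n + 2 := ⟨L - 2, by omega⟩
  obtain ⟨s, t, hs, ht, hA⟩ := akltTensor_eq_of_sq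
  exact aklt_exists_boundary_of_slices hA hs ht n ψ hψ

end QLattice

end Literature.MathematicalPhysics.QuantumLattice
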